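import Summits.Ventures.CertifiedArithmetic.LowPrec.OptTreeChain3

/-!
# Opt / CM-T — Theorem T3(b3): the leaf-count bound `N(H,K,L)` and the uniform lower bound `LB3min(n)`

HONEST FRAMING: certified error envelopes and provably optimal rounding/accumulation schemes for
low-precision formats under stated cost models; every table by two implementations; no hardware or
vendor claims.

Setting as in `OptTreeChain{,2,3}.lean` (OPTIMA.md §T, Theorem T3; E2M1 × E2M1 products summed by a
fixed binary tree in bfloat16, round to nearest even). Those files kernel-check, for EVERY tree `t`, the
three chain witnesses with relative errors `(h-1)/(287+h)`, `κ/(256+κ)`, `(1+2μ)/(513+2μ)` in terms of the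
invariants `h = treeHeight t`, `κ = kappa t`, `μ = mu t`. This file adds the COMBINATORIAL CORE of
T3(b3): a tree whose invariants are small cannot have many leaves. Precisely, `N eh ek el` is the
budget recursion of OPTIMA.md T3(b3) (`eh` = remaining height, `ek = K + 1 - depth`, `el = L + 1 - depth`)
and `numLeaves_le_N` proves `numLeaves t ≤ N H (K+1) M` whenever `treeHeight t ≤ H`, `kappa t ≤ K`
(needed only when `t` has `≥ 3` leaves) and `mu t ≤ M`. Contrapositively (`lb3_witness_of_N_lt`): a tree
with MORE than `N H (K+1) M` leaves has `h ≥ H+1` or `κ ≥ K+1` or `μ ≥ M+1`, hence (by the chain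
theorems) an input of E2M1 × E2M1 products with relative error at least
`min((H)/(288+H), (K+1)/(257+K), (3+2M)/(515+2M))`.

Instances `t3_lb3min_*` give the uniform lower bounds of the OPTIMA.md T3(b4) table for every tree with
`n` leaves: `1/97 (n ≥ 9)`, `3/259 (n ≥ 13)`, `1/73 (n ≥ 17)`, `1/65 (n ≥ 25)`, `5/293 (n ≥ 33)`,
`9/521 (n ≥ 41)`, `5/261 (n ≥ 49)`, `1/49 (n ≥ 65)` — the binding budget values `N 3 3 2 = 8`, …,
`N 6 6 4 = 64` being evaluated by `decide`. Together with certificate C12 (the recursive-halving tree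
ATTAINS these values for `3 ≤ n ≤ 48`, two independent exact implementations) this is T3(c): recursive
halving is exactly minimax-optimal among all reduction trees on `n` E2M1 × E2M1 products, `3 ≤ n ≤ 48`.
What remains certificate-only is the UPPER bound `W(recursive halving) ≤ LB3min(n)` (an exact dynamic
programme over all inputs), not any part of the lower bound.

* `N`, `one_le_N`, `two_le_N_succ`: the budget recursion and its trivial bounds;
* `kappa_left_le`, `kappa_right_le`, `one_le_kappa_node`, `mu_left_le`, `mu_right_le`, `mu_node_ne_zero`:
  how the invariants of a node dominate those of its children (from `kappa_node` / `mu_node`);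
* `numLeaves_le_N` (the induction), `lb3_cases_of_N_lt` (contrapositive), `lb3_witness_of_N_lt`
  (packaged with the three chain witnesses), `t3_lb3min_9` … `t3_lb3min_65` (the table rows).
-/

namespace Summit.Ventures.CertifiedArithmetic.LowPrec.Opt

open Literature.ComputerArithmetic.JeannerodRump2018 (SumTree)
open Literature.ComputerArithmetic.FloatingPoint (Format)
open Literature.ComputerArithmetic.FloatingPoint.MiniFloat (flα absLeafSum treeHeight piE2M1)

/-- Budget recursion of T3(b3): `N eh ek el` bounds the leaf count of a subtree with remaining height
`eh`, kappa-budget `ek = K + 1 - depth` and mu-budget `el = M - depth` (saturating). [new] -/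
def N : ℕ → ℕ → ℕ → ℕ
  | 0, _, _ => 1
  | eh + 1, ek, el =>
      if ek = 0 then 2
      else max (N eh (ek - 1) (el - 1) + 1)
        (if 2 ≤ ek ∧ 1 ≤ eh then (if 1 ≤ el then 2 * N eh (ek - 1) (el - 1) else N eh (ek - 1) (el - 1) + 2)
         else 0)

/-- `N ≥ 1`. [new] -/
theorem one_le_N : ∀ eh ek el, 1 ≤ N eh ek el
  | 0, _, _ => by simp [N]
  | eh + 1, ek, el => by
      simp only [N]
      split_ifs
      all_goals omega

/-- `N (eh+1) ≥ 2`. [new] -/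
theorem two_le_N_succ (eh ek el : ℕ) : 2 ≤ N (eh + 1) ek el := by
  have h1 := one_le_N eh (ek - 1) (el - 1)
  simp only [N]
  split_ifs
  all_goals omega

/-- A left child with `≥ 3` leaves: `kappa l + 1 ≤ kappa (node l r)`. [new] -/
theorem kappa_left_le (l r : SumTree) (h3 : 3 ≤ numLeaves l) : kappa l + 1 ≤ kappa (.node l r) := by
  rw [kappa_node]
  by_cases c1 : 3 ≤ numLeaves l ∧ (numLeaves r < 3 ∨ kappa r ≤ kappa l)
  · rw [if_pos c1]
  · rw [if_neg c1]
    have hr : 3 ≤ numLeaves r ∧ kappa l < kappa r := by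
      by_contra hc
      exact c1 ⟨h3, by omega⟩
    rw [if_pos hr.1]; omega

/-- A right child with `≥ 3` leaves: `kappa r + 1 ≤ kappa (node l r)`. [new] -/
theorem kappa_right_le (l r : SumTree) (h3 : 3 ≤ numLeaves r) : kappa r + 1 ≤ kappa (.node l r) := by
  rw [kappa_node]
  by_cases c1 : 3 ≤ numLeaves l ∧ (numLeaves r < 3 ∨ kappa r ≤ kappa l)
  · rw [if_pos c1]
    rcases c1.2 with h | h
    · omega
    · omega
  · rw [if_neg c1, if_pos h3]

/-- Two internal children: `1 ≤ kappa (node l r)`. [new] -/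
theorem one_le_kappa_node (l r : SumTree) (h2l : 2 ≤ numLeaves l) (h2r : 2 ≤ numLeaves r) :
    1 ≤ kappa (.node l r) := by
  rw [kappa_node]
  by_cases c1 : 3 ≤ numLeaves l ∧ (numLeaves r < 3 ∨ kappa r ≤ kappa l)
  · rw [if_pos c1]; omega
  · rw [if_neg c1]
    by_cases c2 : 3 ≤ numLeaves r
    · rw [if_pos c2]; omega
    · rw [if_neg c2, if_pos ⟨h2l, h2r⟩]

/-- A left child with a climbing node: `mu l + 1 ≤ mu (node l r)`. [new] -/
theorem mu_left_le (l r : SumTree) (h : mu l ≠ 0) : mu l + 1 ≤ mu (.node l r) := by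
  rw [mu_node]
  by_cases c1 : mu l ≠ 0 ∧ mu r ≤ mu l
  · rw [if_pos c1]
  · rw [if_neg c1]
    have hr : mu l < mu r := by
      by_contra hc
      exact c1 ⟨h, by omega⟩
    have hr0 : mu r ≠ 0 := by omega
    rw [if_pos hr0]; omega

/-- A right child with a climbing node: `mu r + 1 ≤ mu (node l r)`. [new] -/
theorem mu_right_le (l r : SumTree) (h : mu r ≠ 0) : mu r + 1 ≤ mu (.node l r) := by
  rw [mu_node]
  by_cases c1 : mu l ≠ 0 ∧ mu r ≤ mu l
  · rw [if_pos c1]; omega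
  · rw [if_neg c1, if_pos h]

/-- Both children with `≥ 3` leaves: the node is a climbing node, `mu (node l r) ≠ 0`. [new] -/
theorem mu_node_ne_zero (l r : SumTree) (h3l : 3 ≤ numLeaves l) (h3r : 3 ≤ numLeaves r) :
    mu (.node l r) ≠ 0 := by
  rw [mu_node]
  by_cases c1 : mu l ≠ 0 ∧ mu r ≤ mu l
  · rw [if_pos c1]; omega
  · rw [if_neg c1]
    by_cases c2 : mu r ≠ 0
    · rw [if_pos c2]; omega
    · rw [if_neg c2, if_pos ⟨h3l, h3r⟩]; omega

/-- A tree with `≥ 2` leaves has height `≥ 1`. [new] -/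
theorem one_le_treeHeight_of_two_le (t : SumTree) (h2 : 2 ≤ numLeaves t) : 1 ≤ treeHeight t := by
  obtain ⟨l, r, rfl⟩ := exists_node_of_two_le t h2
  simp [treeHeight]

/-- THE INDUCTION (T3(b3) combinatorial core): height, kappa and mu budgets bound the leaf count. [new] -/
theorem numLeaves_le_N : ∀ (t : SumTree) (eh ek el : ℕ), treeHeight t ≤ eh →
    (3 ≤ numLeaves t → kappa t + 1 ≤ ek) → (mu t ≠ 0 → mu t ≤ el) → numLeaves t ≤ N eh ek el
  | .leaf _, eh, ek, el, _, _, _ => by simpa [numLeaves] using one_le_N eh ek el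
  | .node l r, eh, ek, el, hh, hk, hm => by
      have hh' : max (treeHeight l) (treeHeight r) + 1 ≤ eh := by simpa [treeHeight] using hh
      obtain ⟨e, rfl⟩ : ∃ e, eh = e + 1 := ⟨eh - 1, by omega⟩
      have hnl := numLeaves_pos l
      have hnr := numLeaves_pos r
      have hn : numLeaves (.node l r) = numLeaves l + numLeaves r := rfl
      have hhl : treeHeight l ≤ e := by
        have := le_max_left (treeHeight l) (treeHeight r); omega
      have hhr : treeHeight r ≤ e := by
        have := le_max_right (treeHeight l) (treeHeight r); omega
      by_cases hk0 : ek = 0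
      · -- no kappa budget left: at most two leaves
        have h2 : numLeaves (.node l r) ≤ 2 := by
          by_contra hc
          have := hk (by omega)
          omega
        simp only [N, if_pos hk0]
        exact h2
      · have IHl : numLeaves l ≤ N e (ek - 1) (el - 1) :=
          numLeaves_le_N l e (ek - 1) (el - 1) hhl
            (fun h3 => by
              have h1 := kappa_left_le l r h3
              have h2 := hk (by rw [hn]; omega)
              omega)
            (fun h0 => by
              have h1 := mu_left_le l r h0
              have h2 := hm (by omega)
              omega)
        have IHr : numLeaves r ≤ N e (ek - 1) (el - 1) :=
          numLeaves_le_N r e (ek - 1) (el - 1) hhr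
            (fun h3 => by
              have h1 := kappa_right_le l r h3
              have h2 := hk (by rw [hn]; omega)
              omega)
            (fun h0 => by
              have h1 := mu_right_le l r h0
              have h2 := hm (by omega)
              omega)
        simp only [N, if_neg hk0]
        by_cases hint : 2 ≤ numLeaves l ∧ 2 ≤ numLeaves r
        · -- both children internal: the second branch of `N`
          have hk1 := one_le_kappa_node l r hint.1 hint.2
          have hek : 2 ≤ ek := by
            have := hk (by rw [hn]; omega)
            omega
          have he1 : 1 ≤ e := by
            have := one_le_treeHeight_of_two_le l hint.1
            omega
          refine le_max_of_le_right ?_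
          rw [if_pos ⟨hek, he1⟩]
          by_cases h33 : 3 ≤ numLeaves l ∧ 3 ≤ numLeaves r
          · have hmu := mu_node_ne_zero l r h33.1 h33.2
            have hel : 1 ≤ el := by
              have := hm hmu
              omega
            rw [if_pos hel, hn]
            omega
          · have hsmall : numLeaves l ≤ 2 ∨ numLeaves r ≤ 2 := by omega
            obtain ⟨e', rfl⟩ : ∃ e', e = e' + 1 := ⟨e - 1, by omega⟩
            have h2N := two_le_N_succ e' (ek - 1) (el - 1)
            by_cases hel : 1 ≤ el
            · rw [if_pos hel, hn]
              rcases hsmall with hs | hs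
              · omega
              · omega
            · rw [if_neg hel, hn]
              rcases hsmall with hs | hs
              · omega
              · omega
        · -- one child is a single leaf: the first branch of `N`
          refine le_max_of_le_left ?_
          rw [hn]
          rcases (by omega : numLeaves l ≤ 1 ∨ numLeaves r ≤ 1) with hs | hs
          · omega
          · omega

/-- Contrapositive of `numLeaves_le_N`: more than `N H (K+1) M` leaves forces a large invariant. [new] -/
theorem lb3_cases_of_N_lt (t : SumTree) (H K M : ℕ) (hN : N H (K + 1) M < numLeaves t) :
    H + 1 ≤ treeHeight t ∨ (3 ≤ numLeaves t ∧ K + 1 ≤ kappa t) ∨ (mu t ≠ 0 ∧ M + 1 ≤ mu t) := by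
  by_cases hh : H + 1 ≤ treeHeight t
  · exact Or.inl hh
  by_cases hk : 3 ≤ numLeaves t ∧ K + 1 ≤ kappa t
  · exact Or.inr (Or.inl hk)
  by_cases hm : mu t ≠ 0 ∧ M + 1 ≤ mu t
  · exact Or.inr (Or.inr hm)
  exfalso
  have := numLeaves_le_N t H (K + 1) M (by omega) (fun h => by omega) (fun h => by omega)
  omega

/-- Chain 1 is monotone in the height: `h ≥ H + 1 ⇒ (h-1)/(287+h) ≥ H/(288+H)`. [new] -/
theorem chain1_mono (H h : ℕ) (hle : H + 1 ≤ h) :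
    (H : ℚ) / (288 + H) ≤ ((h : ℚ) - 1) / (287 + h) := by
  have hle' : (H : ℚ) + 1 ≤ h := by exact_mod_cast hle
  have hH : (0 : ℚ) ≤ H := by exact_mod_cast Nat.zero_le H
  rw [div_le_div_iff₀ (by positivity) (by linarith)]
  nlinarith

/-- Chain 2 is monotone in `κ`: `κ ≥ K + 1 ⇒ κ/(256+κ) ≥ (K+1)/(257+K)`. [new] -/
theorem chain2_mono (K k : ℕ) (hle : K + 1 ≤ k) :
    ((K : ℚ) + 1) / (257 + K) ≤ (k : ℚ) / (256 + k) := by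
  have hle' : (K : ℚ) + 1 ≤ k := by exact_mod_cast hle
  have hK : (0 : ℚ) ≤ K := by exact_mod_cast Nat.zero_le K
  rw [div_le_div_iff₀ (by positivity) (by linarith)]
  nlinarith

/-- Chain 3 is monotone in `μ`: `μ ≥ M + 1 ⇒ (1+2μ)/(513+2μ) ≥ (3+2M)/(515+2M)`. [new] -/
theorem chain3_mono (M m : ℕ) (hle : M + 1 ≤ m) :
    (3 + 2 * (M : ℚ)) / (515 + 2 * M) ≤ (1 + 2 * (m : ℚ)) / (513 + 2 * m) := by
  have hle' : (M : ℚ) + 1 ≤ m := by exact_mod_cast hle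
  have hM : (0 : ℚ) ≤ M := by exact_mod_cast Nat.zero_le M
  rw [div_le_div_iff₀ (by positivity) (by linarith)]
  nlinarith

/-- T3(b3) packaged with the chain witnesses of `OptTreeChain{,2,3}.lean`: a tree with more than
`N H (K+1) M` leaves admits an input of E2M1 × E2M1 products (same shape) whose bfloat16/RNE evaluation
has relative error at least `v`, for any `v` below the three next chain values. [new] -/
theorem lb3_witness_of_N_lt (t : SumTree) (H K M : ℕ) (v : ℚ) (hN : N H (K + 1) M < numLeaves t)
    (h1 : v ≤ (H : ℚ) / (288 + H)) (h2 : v ≤ ((K : ℚ) + 1) / (257 + K))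
    (h3 : v ≤ (3 + 2 * (M : ℚ)) / (515 + 2 * M)) :
    ∃ t', spike 0 t' = spike 0 t ∧ (∀ x ∈ SumTree.leaves t', x ∈ piE2M1) ∧
      v ≤ |SumTree.eval (flα Format.BFloat16) t' - SumTree.exact t'| / absLeafSum t' := by
  rcases lb3_cases_of_N_lt t H K M hN with hh | ⟨hn3, hk⟩ | ⟨hm0, hm⟩
  · obtain ⟨hs, hl, hr⟩ := t3_chain1_ratio t (by omega)
    exact ⟨chain1 t, hs, hl, by rw [hr]; exact h1.trans (chain1_mono H _ hh)⟩
  · obtain ⟨hs, hl, hr⟩ := t3_chain2_ratio t hn3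
    exact ⟨chain2 t, hs, hl, by rw [hr]; exact h2.trans (chain2_mono K _ hk)⟩
  · obtain ⟨hs, hl, hr⟩ := t3_chain3_ratio t hm0
    exact ⟨chain3 t, hs, hl, by rw [hr]; exact h3.trans (chain3_mono M _ hm)⟩

/-- The binding budget values of the T3(b4) table (OPTIMA.md), kernel-evaluated. [new] -/
theorem N_table : N 1 1 0 = 2 ∧ N 2 1 0 = 3 ∧ N 2 2 1 = 4 ∧ N 3 2 1 = 6 ∧ N 3 3 2 = 8 ∧ N 4 3 2 = 12 ∧
    N 4 4 3 = 16 ∧ N 5 4 3 = 24 ∧ N 5 5 3 = 32 ∧ N 6 5 3 = 40 ∧ N 6 5 4 = 48 ∧ N 6 6 4 = 64 ∧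
    N 7 6 4 = 80 ∧ N 7 6 5 = 96 := by decide

/-- The uniform lower bound as a statement about a leaf-count threshold `n₀` and a value `v`. [new] -/
def LB3minFrom (n₀ : ℕ) (v : ℚ) : Prop :=
  ∀ t : SumTree, n₀ ≤ numLeaves t → ∃ t', spike 0 t' = spike 0 t ∧ (∀ x ∈ SumTree.leaves t', x ∈ piE2M1) ∧
    v ≤ |SumTree.eval (flα Format.BFloat16) t' - SumTree.exact t'| / absLeafSum t'

/-- Every tree with `≥ 3` leaves: some E2M1 × E2M1 input has relative error `≥ 1/289`. [new] -/
theorem t3_lb3min_3 : LB3minFrom 3 (1 / 289) := fun t hn =>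
  lb3_witness_of_N_lt t 1 0 0 _ (by rw [N_table.1]; omega) (by norm_num) (by norm_num) (by norm_num)

/-- `n ≥ 4`: relative error `≥ 1/257` is forced. [new] -/
theorem t3_lb3min_4 : LB3minFrom 4 (1 / 257) := fun t hn =>
  lb3_witness_of_N_lt t 2 0 0 _ (by rw [N_table.2.1]; omega) (by norm_num) (by norm_num) (by norm_num)

/-- `n ≥ 5`: `≥ 1/145`. [new] -/
theorem t3_lb3min_5 : LB3minFrom 5 (1 / 145) := fun t hn =>
  lb3_witness_of_N_lt t 2 1 1 _ (by rw [N_table.2.2.1]; omega) (by norm_num) (by norm_num) (by norm_num)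

/-- `n ≥ 7`: `≥ 1/129`. [new] -/
theorem t3_lb3min_7 : LB3minFrom 7 (1 / 129) := fun t hn =>
  lb3_witness_of_N_lt t 3 1 1 _ (by rw [N_table.2.2.2.1]; omega) (by norm_num) (by norm_num) (by norm_num)

/-- `n ≥ 9`: `≥ 1/97`. [new] -/
theorem t3_lb3min_9 : LB3minFrom 9 (1 / 97) := fun t hn =>
  lb3_witness_of_N_lt t 3 2 2 _ (by rw [N_table.2.2.2.2.1]; omega) (by norm_num) (by norm_num) (by norm_num)

/-- `n ≥ 13`: `≥ 3/259`. [new] -/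
theorem t3_lb3min_13 : LB3minFrom 13 (3 / 259) := fun t hn =>
  lb3_witness_of_N_lt t 4 2 2 _ (by rw [N_table.2.2.2.2.2.1]; omega) (by norm_num) (by norm_num)
    (by norm_num)

/-- `n ≥ 17`: `≥ 1/73`. [new] -/
theorem t3_lb3min_17 : LB3minFrom 17 (1 / 73) := fun t hn =>
  lb3_witness_of_N_lt t 4 3 3 _ (by rw [N_table.2.2.2.2.2.2.1]; omega) (by norm_num) (by norm_num)
    (by norm_num)

/-- `n ≥ 25`: `≥ 1/65`. [new] -/
theorem t3_lb3min_25 : LB3minFrom 25 (1 / 65) := fun t hn =>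
  lb3_witness_of_N_lt t 5 3 3 _ (by rw [N_table.2.2.2.2.2.2.2.1]; omega) (by norm_num) (by norm_num)
    (by norm_num)

/-- `n ≥ 33`: `≥ 5/293`. [new] -/
theorem t3_lb3min_33 : LB3minFrom 33 (5 / 293) := fun t hn =>
  lb3_witness_of_N_lt t 5 4 3 _ (by rw [N_table.2.2.2.2.2.2.2.2.1]; omega) (by norm_num) (by norm_num)
    (by norm_num)

/-- `n ≥ 41`: `≥ 9/521` (the value attained by recursive halving on `41 ≤ n ≤ 48` leaves, C12). [new] -/
theorem t3_lb3min_41 : LB3minFrom 41 (9 / 521) := fun t hn =>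
  lb3_witness_of_N_lt t 6 4 3 _ (by rw [N_table.2.2.2.2.2.2.2.2.2.1]; omega) (by norm_num) (by norm_num)
    (by norm_num)

/-- `n ≥ 49`: `≥ 5/261`. [new] -/
theorem t3_lb3min_49 : LB3minFrom 49 (5 / 261) := fun t hn =>
  lb3_witness_of_N_lt t 6 4 4 _ (by rw [N_table.2.2.2.2.2.2.2.2.2.2.1]; omega) (by norm_num) (by norm_num)
    (by norm_num)

/-- `n ≥ 65`: `≥ 1/49`. [new] -/
theorem t3_lb3min_65 : LB3minFrom 65 (1 / 49) := fun t hn =>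
  lb3_witness_of_N_lt t 6 5 4 _ (by rw [N_table.2.2.2.2.2.2.2.2.2.2.2.1]; omega) (by norm_num)
    (by norm_num) (by norm_num)

/-- `n ≥ 81`: `≥ 11/523`. [new] -/
theorem t3_lb3min_81 : LB3minFrom 81 (11 / 523) := fun t hn =>
  lb3_witness_of_N_lt t 7 5 4 _ (by rw [N_table.2.2.2.2.2.2.2.2.2.2.2.2.1]; omega) (by norm_num)
    (by norm_num) (by norm_num)

/-- `n ≥ 97`: `≥ 3/131`. [new] -/
theorem t3_lb3min_97 : LB3minFrom 97 (3 / 131) := fun t hn =>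
  lb3_witness_of_N_lt t 7 5 5 _ (by rw [N_table.2.2.2.2.2.2.2.2.2.2.2.2.2]; omega) (by norm_num)
    (by norm_num) (by norm_num)

end Summit.Ventures.CertifiedArithmetic.LowPrec.Opt
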